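import Mathlib
import Summits.QuantumFields.YangMills.Theorems.EguchiKawaiDirectionLadderHaarNestedPattern
import Summits.QuantumFields.YangMills.Theorems.EguchiKawaiDirectionLadderHaarOffDiagCombinatorics
import HarnessLib

/-!
# `N`-uniform small-ball bound for the off-diagonal blocks of a Haar unitary

The random-matrix input (RMT) of `singleLinkRigidity_of_blocks_of_offDiagSmallBall` (stub B1
`stub_singleLinkRigidity` of crux `DirectionIncrement`, route `EguchiKawaiDirectionLadder`), in exactly
the form required there (`haar_offDiagBlockSq_smallBall`): for every number of blocks `m` there is
`C_m ≥ 0` (in fact `C_m = 10` works for all `m`) such that for all `N`, every block labelling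
`ℓ : Fin N → Option (Fin m)` and `0 < s ≤ 1`,

  `Haar{W ∈ U(N) : offDiagBlockSq ℓ W ≤ N s} ≤ exp(C_m N²) · s^{labelPairCount ℓ / 2}`.

This is the Hilbert–Schmidt small-ball (metric-entropy) estimate for `U(N)/(U(n₁) × ⋯ × U(n_m))`
(Szarek, *Metric entropy of homogeneous spaces*, arXiv:math/9701213, in the exponent-only form needed
here), proved by elementary means: sort the indices by label (`haar_offDiag_perm`), bound the
off-diagonal mass below by the nested column sums `∑_k ∑_{j ∈ T_k} |W_{jk}|²`
(`sum_laterDiff_le_offDiagBlockSq`, `∑_k |T_k| = labelPairCount/2`), distribute the budget `N s` over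
the columns dyadically (`exists_alloc`, at most `(L+1)^N ≤ e^{2N²}` patterns) and apply the
column-by-column bound `haar_measure_nestedPattern_le`; the bookkeeping `prod_colBound_le` shows that
every pattern contributes at most `e^{7N²} s^{∑|T_k|}`. All [folklore].
-/

noncomputable section

open MeasureTheory Finset Real
open Literature.Barriers.QuantumFields
open Literature.MathematicalPhysics.QuantumFieldTheory (haarProbability)
open scoped ENNReal

namespace Summit.QuantumFields.YangMills.Theorems.EguchiKawaiDirectionLadder.HaarColumns

/-! ### Elementary exponential bookkeeping -/

/-- `s · log(1 / min(4s, 1)) ≤ 1/4` for `s > 0`. [folklore] -/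
theorem mul_log_inv_min_le {s : ℝ} (hs : 0 < s) : s * Real.log (1 / min (4 * s) 1) ≤ 1 / 4 := by
  by_cases h : 4 * s ≤ 1
  · rw [min_eq_left h]
    have h4s : 0 < 4 * s := by linarith
    have hlog : Real.log (1 / (4 * s)) ≤ 1 / (4 * s) - 1 := Real.log_le_sub_one_of_pos (by positivity)
    calc s * Real.log (1 / (4 * s)) ≤ s * (1 / (4 * s) - 1) := mul_le_mul_of_nonneg_left hlog hs.le
      _ = 1 / 4 - s := by field_simp
      _ ≤ 1 / 4 := by linarith
  · push Not at h
    rw [min_eq_right h.le, div_one, Real.log_one, mul_zero]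
    norm_num

/-- If `∑_k 2^{a_k} ≤ 3N` then `∑_k a_k ≤ 2N` (`a + 1 ≤ 2^a`). [folklore] -/
theorem sum_le_two_mul_of_sum_two_pow_le {N : ℕ} (a : Fin N → ℕ) (ha : ∑ k, 2 ^ (a k) ≤ 3 * N) :
    ∑ k, a k ≤ 2 * N := by
  have h1 : ∑ k, (a k + 1) ≤ ∑ k, 2 ^ (a k) :=
    Finset.sum_le_sum fun k _ => Nat.lt_two_pow_self
  rw [Finset.sum_add_distrib, Finset.sum_const, Finset.card_univ, Fintype.card_fin, smul_eq_mul,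
    mul_one] at h1
  omega

/-- **Per-pattern bookkeeping.** For block sizes `Tc_k ≤ N`, dyadic levels `a_k` with
`∑ 2^{a_k} ≤ 3N`, defects `e_k ≤ ⌊6Ns⌋` and `0 < s`:
`∏_k 2^{N-1} (min(4 s 2^{a_k}, 1))^{Tc_k - e_k} ≤ e^{7N²} s^{∑ Tc_k}`. [folklore] -/
theorem prod_colBound_le {N : ℕ} (Tc a e : Fin N → ℕ) (hTc : ∀ k, Tc k ≤ N)
    (ha : ∑ k, 2 ^ (a k) ≤ 3 * N) {s : ℝ} (hs : 0 < s)
    (he : ∀ k, e k ≤ ⌊6 * N * s⌋₊) :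
    ∏ k, (2 : ℝ) ^ (N - 1) * (min (4 * (s * 2 ^ (a k))) 1) ^ (Tc k - e k) ≤
      Real.exp (7 * (N : ℝ) ^ 2) * s ^ (∑ k, Tc k) := by
  set v : ℝ := min (4 * s) 1 with hv
  have hv0 : 0 < v := lt_min (by linarith) one_pos
  have hv1 : v ≤ 1 := min_le_right _ _
  set E : ℕ := ⌊6 * N * s⌋₊ with hE
  set D : ℕ := ∑ k, Tc k with hD
  have hDN : D ≤ N * N := by
    calc D = ∑ k, Tc k := rfl
      _ ≤ ∑ _k : Fin N, N := Finset.sum_le_sum fun k _ => hTc k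
      _ = N * N := by simp
  -- per column
  have hcol : ∀ k, (min (4 * (s * 2 ^ (a k))) 1) ^ (Tc k - e k) ≤
      (4 * (s * 2 ^ (a k))) ^ (Tc k) * (1 / v) ^ E := by
    intro k
    set z : ℝ := min (4 * (s * 2 ^ (a k))) 1 with hz
    have hy0 : 0 ≤ 4 * (s * 2 ^ (a k)) := by positivity
    have hz0 : 0 < z := lt_min (by positivity) one_pos
    have hz1 : z ≤ 1 := min_le_right _ _
    have hvz : v ≤ z := by
      refine le_min ?_ hv1
      calc v ≤ 4 * s := min_le_left _ _
        _ = 4 * (s * 1) := by ring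
        _ ≤ 4 * (s * 2 ^ (a k)) := by gcongr; exact one_le_pow₀ (by norm_num)
    have hzy : z ≤ 4 * (s * 2 ^ (a k)) := min_le_left _ _
    -- `z^{Tc-e} v^E ≤ z^{Tc-e} z^{min e Tc} = z^{Tc}`
    have h1 : z ^ (Tc k - e k) * v ^ E ≤ z ^ (Tc k) := by
      have hminE : min (e k) (Tc k) ≤ E := (min_le_left _ _).trans (he k)
      calc z ^ (Tc k - e k) * v ^ E ≤ z ^ (Tc k - e k) * v ^ (min (e k) (Tc k)) :=
            mul_le_mul_of_nonneg_left (pow_le_pow_of_le_one hv0.le hv1 hminE) (by positivity)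
        _ ≤ z ^ (Tc k - e k) * z ^ (min (e k) (Tc k)) :=
            mul_le_mul_of_nonneg_left (pow_le_pow_left₀ hv0.le hvz _) (by positivity)
        _ = z ^ (Tc k) := by
            rw [← pow_add]; congr 1; omega
    have h2 : z ^ (Tc k) ≤ (4 * (s * 2 ^ (a k))) ^ (Tc k) := pow_le_pow_left₀ hz0.le hzy _
    have hvE : 0 < v ^ E := pow_pos hv0 E
    rw [one_div, inv_pow, ← div_eq_mul_inv, le_div_iff₀ hvE]
    exact h1.trans h2
  -- the product
  have hprod : ∏ k, (2 : ℝ) ^ (N - 1) * (min (4 * (s * 2 ^ (a k))) 1) ^ (Tc k - e k) ≤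
      ∏ k, (2 : ℝ) ^ (N - 1) * ((4 * (s * 2 ^ (a k))) ^ (Tc k) * (1 / v) ^ E) := by
    refine Finset.prod_le_prod (fun k _ => by positivity) fun k _ => ?_
    exact mul_le_mul_of_nonneg_left (hcol k) (by positivity)
  refine hprod.trans ?_
  -- evaluate the right-hand side
  have hmid : ∏ k, (4 * (s * 2 ^ (a k))) ^ (Tc k) = (4 : ℝ) ^ D * s ^ D * 2 ^ (∑ k, a k * Tc k) := by
    rw [hD, ← Finset.prod_pow_eq_pow_sum, ← Finset.prod_pow_eq_pow_sum, ← Finset.prod_pow_eq_pow_sum,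
      ← Finset.prod_mul_distrib, ← Finset.prod_mul_distrib]
    refine Finset.prod_congr rfl fun k _ => ?_
    rw [mul_pow, mul_pow, pow_mul]; ring
  have hrhs : ∏ k, (2 : ℝ) ^ (N - 1) * ((4 * (s * 2 ^ (a k))) ^ (Tc k) * (1 / v) ^ E) =
      (2 : ℝ) ^ ((N - 1) * N) * (((4 : ℝ) ^ D * s ^ D * 2 ^ (∑ k, a k * Tc k)) * ((1 / v) ^ E) ^ N) := by
    rw [Finset.prod_mul_distrib, Finset.prod_mul_distrib, Finset.prod_const, Finset.prod_const,
      Finset.card_univ, Fintype.card_fin, ← pow_mul, hmid]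
  rw [hrhs]
  -- bound each factor (`2^n ≤ e^n`)
  have two_pow_le_exp : ∀ n : ℕ, (2 : ℝ) ^ n ≤ Real.exp n := by
    intro n
    have h2 : (2 : ℝ) ≤ Real.exp 1 := by
      have := Real.add_one_le_exp (1 : ℝ); linarith
    calc (2 : ℝ) ^ n ≤ (Real.exp 1) ^ n := pow_le_pow_left₀ (by norm_num) h2 n
      _ = Real.exp n := by rw [← Real.exp_nat_mul, mul_one]
  have hN0 : (0 : ℝ) ≤ N := Nat.cast_nonneg N
  have hA : (2 : ℝ) ^ ((N - 1) * N) ≤ Real.exp ((N : ℝ) ^ 2) := by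
    calc (2 : ℝ) ^ ((N - 1) * N) ≤ 2 ^ (N * N) := pow_le_pow_right₀ (by norm_num)
          (Nat.mul_le_mul_right _ (Nat.sub_le _ _))
      _ ≤ Real.exp ((N * N : ℕ) : ℝ) := two_pow_le_exp _
      _ = Real.exp ((N : ℝ) ^ 2) := by push_cast; ring_nf
  have hB : (4 : ℝ) ^ D ≤ Real.exp (2 * (N : ℝ) ^ 2) := by
    calc (4 : ℝ) ^ D ≤ 4 ^ (N * N) := pow_le_pow_right₀ (by norm_num) hDN
      _ = 2 ^ (2 * (N * N)) := by rw [show (4 : ℝ) = 2 ^ 2 by norm_num, ← pow_mul]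
      _ ≤ Real.exp ((2 * (N * N) : ℕ) : ℝ) := two_pow_le_exp _
      _ = Real.exp (2 * (N : ℝ) ^ 2) := by push_cast; ring_nf
  have hC : (2 : ℝ) ^ (∑ k, a k * Tc k) ≤ Real.exp (2 * (N : ℝ) ^ 2) := by
    have hsum : ∑ k, a k * Tc k ≤ 2 * N * N := by
      calc ∑ k, a k * Tc k ≤ ∑ k, a k * N := Finset.sum_le_sum fun k _ => Nat.mul_le_mul_left _ (hTc k)
        _ = (∑ k, a k) * N := by rw [Finset.sum_mul]
        _ ≤ 2 * N * N := Nat.mul_le_mul_right _ (sum_le_two_mul_of_sum_two_pow_le a ha)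
    calc (2 : ℝ) ^ (∑ k, a k * Tc k) ≤ 2 ^ (2 * N * N) := pow_le_pow_right₀ (by norm_num) hsum
      _ ≤ Real.exp ((2 * N * N : ℕ) : ℝ) := two_pow_le_exp _
      _ = Real.exp (2 * (N : ℝ) ^ 2) := by push_cast; ring_nf
  have hDv : ((1 / v) ^ E) ^ N ≤ Real.exp (3 / 2 * (N : ℝ) ^ 2) := by
    rw [← pow_mul]
    have h1v : 1 ≤ 1 / v := by rw [le_div_iff₀ hv0]; linarith
    have hlog0 : 0 ≤ Real.log (1 / v) := Real.log_nonneg h1v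
    rw [← Real.exp_log (show (0 : ℝ) < 1 / v by positivity), ← Real.exp_nat_mul]
    refine Real.exp_le_exp.2 ?_
    have hE' : (E : ℝ) ≤ 6 * N * s := Nat.floor_le (by positivity)
    have hsl : s * Real.log (1 / v) ≤ 1 / 4 := mul_log_inv_min_le hs
    calc ((E * N : ℕ) : ℝ) * Real.log (1 / v) = (E : ℝ) * N * Real.log (1 / v) := by push_cast; ring
      _ ≤ (6 * N * s) * N * Real.log (1 / v) := by gcongr
      _ = 6 * (N : ℝ) ^ 2 * (s * Real.log (1 / v)) := by ring
      _ ≤ 6 * (N : ℝ) ^ 2 * (1 / 4) := by gcongr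
      _ = 3 / 2 * (N : ℝ) ^ 2 := by ring
  have hsD : 0 ≤ s ^ D := pow_nonneg hs.le D
  calc (2 : ℝ) ^ ((N - 1) * N) * (((4 : ℝ) ^ D * s ^ D * 2 ^ (∑ k, a k * Tc k)) * ((1 / v) ^ E) ^ N)
      ≤ Real.exp ((N : ℝ) ^ 2) * ((Real.exp (2 * (N : ℝ) ^ 2) * s ^ D * Real.exp (2 * (N : ℝ) ^ 2)) *
          Real.exp (3 / 2 * (N : ℝ) ^ 2)) := by gcongr
    _ = Real.exp ((13 : ℝ) / 2 * (N : ℝ) ^ 2) * s ^ D := by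
        rw [show (13 : ℝ) / 2 * (N : ℝ) ^ 2 = (N : ℝ) ^ 2 + 2 * (N : ℝ) ^ 2 + 2 * (N : ℝ) ^ 2 +
          3 / 2 * (N : ℝ) ^ 2 by ring, Real.exp_add, Real.exp_add, Real.exp_add]
        ring
    _ ≤ Real.exp (7 * (N : ℝ) ^ 2) * s ^ D := by gcongr; norm_num

/-- The number of dyadic patterns: `(⌊log₂ N⌋ + 2)^N ≤ e^{2N²}`. [folklore] -/
theorem card_levels_pow_le_exp (N : ℕ) : ((Nat.log 2 N + 1 + 1 : ℕ) : ℝ) ^ N ≤ Real.exp (2 * (N : ℝ) ^ 2) := by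
  have hL : Nat.log 2 N + 1 + 1 ≤ N + 2 := by
    have := Nat.log_le_self 2 N; omega
  have h1 : ((Nat.log 2 N + 1 + 1 : ℕ) : ℝ) ≤ Real.exp ((N : ℝ) + 1) := by
    calc ((Nat.log 2 N + 1 + 1 : ℕ) : ℝ) ≤ ((N + 2 : ℕ) : ℝ) := by exact_mod_cast hL
      _ = ((N : ℝ) + 1) + 1 := by push_cast; ring
      _ ≤ Real.exp ((N : ℝ) + 1) := Real.add_one_le_exp _
  calc ((Nat.log 2 N + 1 + 1 : ℕ) : ℝ) ^ N ≤ (Real.exp ((N : ℝ) + 1)) ^ N :=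
        pow_le_pow_left₀ (by positivity) h1 N
    _ = Real.exp (N * ((N : ℝ) + 1)) := by rw [← Real.exp_nat_mul]
    _ ≤ Real.exp (2 * (N : ℝ) ^ 2) := by
        refine Real.exp_le_exp.2 ?_
        have : (N : ℝ) * 1 ≤ (N : ℝ) ^ 2 := by
          rcases Nat.eq_zero_or_pos N with h | h
          · subst h; simp
          · have : (1 : ℝ) ≤ N := by exact_mod_cast h
            nlinarith
        nlinarith [sq_nonneg (N : ℝ)]

/-! ### The main bound -/

/-- **`N`-uniform small-ball bound for the off-diagonal blocks of a Haar unitary** (the input (RMT)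
of `singleLinkRigidity_of_blocks_of_offDiagSmallBall`, verbatim): for every `m` there is `C_m ≥ 0`
with `Haar{W : offDiagBlockSq ℓ W ≤ N s} ≤ exp(C_m N²) · s^{labelPairCount ℓ / 2}` for all `N`, all
labellings `ℓ : Fin N → Option (Fin m)` and all `0 < s ≤ 1` (here `C_m = 10`). Hilbert–Schmidt
metric entropy of the partial flag manifolds `U(N)/(U(n₁)×⋯×U(n_m))` in exponent-only form, by the
column-by-column Gaussian argument. [folklore] -/
theorem haar_offDiagBlockSq_smallBall :
    ∀ m : ℕ, ∃ Cm : ℝ, 0 ≤ Cm ∧ ∀ N : ℕ, ∀ ℓ : Fin N → Option (Fin m), ∀ s : ℝ, 0 < s → s ≤ 1 →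
      haarProbability (UN N)
          {W : UN N | offDiagBlockSq ℓ (W : Matrix (Fin N) (Fin N) ℂ) ≤ N * s} ≤
        ENNReal.ofReal (Real.exp (Cm * (N : ℝ) ^ 2) * s ^ ((labelPairCount ℓ : ℝ) / 2)) := by
  intro m
  refine ⟨10, by norm_num, fun N ℓ s hs hs1 => ?_⟩
  classical
  -- sort the labels
  obtain ⟨σ, hsorted⟩ := exists_perm_sorted ℓ
  rw [haar_offDiag_perm ℓ σ, ← labelPairCount_comp_perm ℓ σ]
  set ℓ' : Fin N → Option (Fin m) := ℓ ∘ σ with hℓ'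
  -- the nested costly sets
  set Tf : Fin N → Finset (Fin N) :=
    fun k => Finset.univ.filter fun j => k < j ∧ ℓ' k ≠ ℓ' j ∧ ℓ' k ≠ none ∧ ℓ' j ≠ none with hTf
  set T : ℕ → Finset (Fin N) := fun k => if h : k < N then Tf ⟨k, h⟩ else ∅ with hT
  have hTk : ∀ k : Fin N, T k = Tf k := fun k => by simp [hT, k.2]
  have hT1 : ∀ k, ∀ j ∈ T k, k < (j : ℕ) := by
    intro k j hj
    by_cases hk : k < N
    · have hj' : j ∈ Tf ⟨k, hk⟩ := by simpa [hT, hk] using hj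
      exact lt_of_mem_laterDiff hj'
    · simp [hT, hk] at hj
  have hT2 : ∀ k l, k ≤ l → T l ⊆ T k := by
    intro k l hkl
    by_cases hl : l < N
    · have hk : k < N := lt_of_le_of_lt hkl hl
      simp only [hT, hl, hk, dif_pos]
      exact laterDiff_subset hsorted (Fin.mk_le_mk.2 hkl)
    · simp [hT, hl]
  set D : ℕ := ∑ k, (Tf k).card with hD
  have h2D : 2 * D = labelPairCount ℓ' := two_mul_sum_card_laterDiff ℓ'
  have hDreal : ((labelPairCount ℓ' : ℝ) / 2) = D := by
    rw [← h2D]; push_cast; ring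
  rw [hDreal, Real.rpow_natCast]
  have hTcN : ∀ k, (Tf k).card ≤ N := fun k => (Finset.card_le_univ _).trans (by simp)
  -- dyadic levels
  set L : ℕ := Nat.log 2 N + 1 with hL
  have hNL : N < 2 ^ L := Nat.lt_pow_succ_log_self one_lt_two N
  set G : Finset (Fin N → Fin (L + 1)) :=
    Finset.univ.filter fun α : Fin N → Fin (L + 1) => ∑ k, 2 ^ (α k : ℕ) ≤ 3 * N with hG
  -- the events
  set E : (Fin N → Fin (L + 1)) → Set (UN N) := fun α =>
    {W : UN N | ∀ k : Fin N, ∑ j ∈ T k, ‖(W : Matrix (Fin N) (Fin N) ℂ) j k‖ ^ 2 ≤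
      s * 2 ^ (α k : ℕ)} with hEdef
  have hsub : {W : UN N | offDiagBlockSq ℓ' (W : Matrix (Fin N) (Fin N) ℂ) ≤ N * s} ⊆ ⋃ α ∈ G, E α := by
    intro W hW
    have hW' : offDiagBlockSq ℓ' (W : Matrix (Fin N) (Fin N) ℂ) ≤ N * s := hW
    have hcsum : ∑ k, ∑ j ∈ Tf k, ‖(W : Matrix (Fin N) (Fin N) ℂ) j k‖ ^ 2 ≤ N * s :=
      (sum_laterDiff_le_offDiagBlockSq ℓ' _).trans hW'
    obtain ⟨α, hαG, hα⟩ := exists_alloc hNL hs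
      (fun k => ∑ j ∈ Tf k, ‖(W : Matrix (Fin N) (Fin N) ℂ) j k‖ ^ 2) (fun k => by positivity) hcsum
    refine Set.mem_biUnion hαG ?_
    intro k
    rw [hTk]
    exact hα k
  -- the bound for one pattern
  have hone : ∀ α ∈ G, haarProbability (UN N) (E α) ≤
      ENNReal.ofReal (Real.exp (7 * (N : ℝ) ^ 2) * s ^ D) := by
    intro α hα
    have hαsum : ∑ k, 2 ^ (α k : ℕ) ≤ 3 * N := (Finset.mem_filter.1 hα).2
    set y : ℕ → ℝ := fun k => if h : k < N then s * 2 ^ (α ⟨k, h⟩ : ℕ) else 0 with hy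
    have hyk : ∀ k : Fin N, y k = s * 2 ^ (α k : ℕ) := fun k => by simp [hy, k.2]
    have hy0 : ∀ k, 0 ≤ y k := by
      intro k; simp only [hy]; split_ifs <;> positivity
    have hev : E α = {W : UN N | ∀ k : Fin N,
        ∑ j ∈ T k, ‖(W : Matrix (Fin N) (Fin N) ℂ) j k‖ ^ 2 ≤ y k} := by
      ext W; simp only [hEdef, Set.mem_setOf_eq, hyk]
    rw [hev]
    refine (haar_measure_nestedPattern_le T y hT1 hT2 hy0).trans ?_
    -- the defects are at most `⌊6 N s⌋`
    have hysum : ∀ k : ℕ, ∑ l ∈ Finset.range k, y l ≤ 3 * N * s := by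
      intro k
      have h1 : ∑ l ∈ Finset.range k, y l ≤ ∑ l ∈ Finset.range N, y l := by
        rcases le_or_gt k N with hk | hk
        · exact Finset.sum_le_sum_of_subset_of_nonneg (Finset.range_mono hk) fun l _ _ => hy0 l
        · rw [← Finset.sum_range_add_sum_Ico _ hk.le]
          have : ∑ l ∈ Finset.Ico N k, y l = 0 :=
            Finset.sum_eq_zero fun l hl => by simp [hy, (Finset.mem_Ico.1 hl).1.not_gt]
          rw [this, add_zero]
      have h2 : ∑ l ∈ Finset.range N, y l = s * ∑ k : Fin N, (2 : ℝ) ^ (α k : ℕ) := by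
        rw [← Fin.sum_univ_eq_sum_range, Finset.mul_sum]
        exact Finset.sum_congr rfl fun k _ => hyk k
      have h3 : ∑ k : Fin N, (2 : ℝ) ^ (α k : ℕ) ≤ 3 * N := by exact_mod_cast hαsum
      calc ∑ l ∈ Finset.range k, y l ≤ s * ∑ k : Fin N, (2 : ℝ) ^ (α k : ℕ) := h1.trans h2.le
        _ ≤ s * (3 * N) := mul_le_mul_of_nonneg_left h3 hs.le
        _ = 3 * N * s := by ring
    have hfloor : ∀ k : Fin N, ⌊2 * ∑ l ∈ Finset.range k, y l⌋₊ ≤ ⌊6 * N * s⌋₊ := by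
      intro k
      refine Nat.floor_mono ?_
      have := hysum k; linarith
    have hreal := prod_colBound_le (fun k => (Tf k).card) (fun k => (α k : ℕ))
      (fun k => ⌊2 * ∑ l ∈ Finset.range k, y l⌋₊) hTcN hαsum hs hfloor
    rw [← Fin.prod_univ_eq_prod_range, ← ENNReal.ofReal_prod_of_nonneg (fun k _ =>
      mul_nonneg (pow_nonneg (by norm_num) _) (pow_nonneg (le_min (by linarith [hy0 k]) zero_le_one) _))]
    refine ENNReal.ofReal_le_ofReal ?_
    refine le_trans (le_of_eq ?_) hreal
    refine Finset.prod_congr rfl fun k _ => ?_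
    rw [hTk, hyk]
  -- assemble
  calc haarProbability (UN N) {W : UN N | offDiagBlockSq ℓ' (W : Matrix (Fin N) (Fin N) ℂ) ≤ N * s}
      ≤ haarProbability (UN N) (⋃ α ∈ G, E α) := measure_mono hsub
    _ ≤ ∑ α ∈ G, haarProbability (UN N) (E α) := measure_biUnion_finset_le _ _
    _ ≤ ∑ α ∈ G, ENNReal.ofReal (Real.exp (7 * (N : ℝ) ^ 2) * s ^ D) := Finset.sum_le_sum hone
    _ = G.card * ENNReal.ofReal (Real.exp (7 * (N : ℝ) ^ 2) * s ^ D) := by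
        rw [Finset.sum_const, nsmul_eq_mul]
    _ ≤ ENNReal.ofReal (((L + 1 : ℕ) : ℝ) ^ N) * ENNReal.ofReal (Real.exp (7 * (N : ℝ) ^ 2) * s ^ D) := by
        gcongr
        rw [← ENNReal.ofReal_natCast]
        refine ENNReal.ofReal_le_ofReal ?_
        exact_mod_cast card_allocSet_le N L
    _ = ENNReal.ofReal (((L + 1 : ℕ) : ℝ) ^ N * (Real.exp (7 * (N : ℝ) ^ 2) * s ^ D)) := by
        rw [← ENNReal.ofReal_mul (by positivity)]
    _ ≤ ENNReal.ofReal (Real.exp (10 * (N : ℝ) ^ 2) * s ^ D) := by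
        refine ENNReal.ofReal_le_ofReal ?_
        have hcard := card_levels_pow_le_exp N
        have hsD : 0 ≤ s ^ D := pow_nonneg hs.le D
        calc ((L + 1 : ℕ) : ℝ) ^ N * (Real.exp (7 * (N : ℝ) ^ 2) * s ^ D)
            ≤ Real.exp (2 * (N : ℝ) ^ 2) * (Real.exp (7 * (N : ℝ) ^ 2) * s ^ D) := by gcongr
          _ = Real.exp (9 * (N : ℝ) ^ 2) * s ^ D := by
              rw [← mul_assoc, ← Real.exp_add]; ring_nf
          _ ≤ Real.exp (10 * (N : ℝ) ^ 2) * s ^ D := by gcongr; norm_num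

end Summit.QuantumFields.YangMills.Theorems.EguchiKawaiDirectionLadder.HaarColumns

end
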